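import Mathlib
import HarnessLib
import Summits.ValiantsHypothesis.ValiantsHypothesis.Theorems.LacunarySymmetroidMatrixDescartesOsculationLawPeelSimpleBranches

/-!
# ValiantsHypothesis / LacunarySymmetroid — crux `MatrixDescartes` (stmt-ValiantsHypothesis-18050, V1),
# line `Cruxes/MatrixDescartes/Lines/osculation_law.lean` («osculation-law»), stub `stub_peel` (ALL ranks):
# THE LOCAL IMPLICIT BRANCH AT A SIMPLE POINT (rank-free)

The second rank-free brick of the general-`r` peel (after `…PeelSimpleBranches`): at a point `(t₀, b₀)` of a
spectral curve `Φ = 0` with `∂_bΦ(t₀, b₀) ≠ 0` the curve is, near `(t₀, b₀)`, the graph of a smooth function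
`b = β(t)` — existence, smoothness AND local uniqueness — by Mathlib's `ContDiffAt.implicitFunction`
(`Mathlib/Analysis/Calculus/ImplicitContDiff`).

* `contDiff_eval₂` — `(t, b) ↦ Φ(t, b)` is `C^ω` on `ℝ × ℝ`.
* `fderiv_eval₂_inr` — the `b`-partial of that map is `∂_bΦ`: `(fderiv f u ∘L inr) 1 = ∂_bΦ(u)`;
  `isInvertible_fderiv_eval₂_inr` — it is invertible iff… whenever `∂_bΦ(u) ≠ 0`.
* **`exists_local_branch`** — `Φ(t₀,b₀) = 0`, `∂_bΦ(t₀,b₀) ≠ 0 ⇒ ∃ β, β t₀ = b₀ ∧ C^ω at t₀ ∧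
  (∀ᶠ t, Φ(t, β t) = 0) ∧ (∀ᶠ v near (t₀,b₀), Φ(v) = 0 ↔ β v.1 = v.2)`.
* **`exists_local_branch_of_hyperbolic`** — for a HYPERBOLIC family in the line's general position with finite
  osculation set, this holds at EVERY curve point of the open quadrant (`rootMultiplicity_le_one_of_finite`:
  the root is simple, so `∂_bΦ ≠ 0`).

Honest framing: rank-free LEMMAS toward the OPEN stub `stub_peel` (all `r`; instances `r ≤ 2` are theorems); the
LAW, `MatrixDescartes`, Conjecture B and `VP ≠ VNP` are NOT proved.  No definitions, no named facts.
-/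

-- `Summit.ValiantsHypothesis.ValiantsHypothesis.…` is the tree's mandated single-conjunct layout (Sub = Summit).
set_option linter.dupNamespace false

noncomputable section

namespace Summit.ValiantsHypothesis.ValiantsHypothesis.Theorems.LacunarySymmetroidMatrixDescartes

open Polynomial Set Filter
open MvPolynomial (pderiv)
open scoped BigOperators Topology

namespace OsculationPeel

/-- `(t, b) ↦ Φ(t, b)` is smooth (indeed analytic) on `ℝ × ℝ`. [folklore] -/
theorem contDiff_eval₂ (Φ : MvPolynomial (Fin 2) ℝ) :
    ContDiff ℝ ⊤ (fun p : ℝ × ℝ => MvPolynomial.eval ![p.1, p.2] Φ) := by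
  induction Φ using MvPolynomial.induction_on with
  | C a => simpa only [MvPolynomial.eval_C] using contDiff_const
  | add p q hp hq => simpa only [map_add] using hp.add hq
  | mul_X p i hp =>
    fin_cases i
    · simpa only [Fin.zero_eta, map_mul, MvPolynomial.eval_X, Matrix.cons_val_zero] using hp.mul contDiff_fst
    · simpa only [Fin.mk_one, map_mul, MvPolynomial.eval_X, Matrix.cons_val_one, Matrix.cons_val_zero]
        using hp.mul contDiff_snd

/-- The `b`-partial of `(t, b) ↦ Φ(t, b)` at `u` is `∂_bΦ(u)`. [folklore] -/
theorem fderiv_eval₂_inr (Φ : MvPolynomial (Fin 2) ℝ) (u : ℝ × ℝ) :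
    (fderiv ℝ (fun p : ℝ × ℝ => MvPolynomial.eval ![p.1, p.2] Φ) u ∘L ContinuousLinearMap.inr ℝ ℝ ℝ) 1 =
      MvPolynomial.eval ![u.1, u.2] (pderiv 1 Φ) := by
  have hF : HasFDerivAt (fun p : ℝ × ℝ => MvPolynomial.eval ![p.1, p.2] Φ)
      (fderiv ℝ (fun p : ℝ × ℝ => MvPolynomial.eval ![p.1, p.2] Φ) u) u :=
    (((contDiff_eval₂ Φ).contDiffAt (x := u)).differentiableAt (by simp)).hasFDerivAt
  have hγ : HasDerivAt (fun b : ℝ => ((u.1, b) : ℝ × ℝ)) ((0 : ℝ), (1 : ℝ)) u.2 :=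
    (hasDerivAt_const u.2 u.1).prodMk (hasDerivAt_id u.2)
  have h1 := hF.comp_hasDerivAt u.2 hγ
  have h2 := hasDerivAt_mvPolynomial_eval Φ (hasDerivAt_const u.2 u.1) (hasDerivAt_id u.2)
  have hfun : ((fun p : ℝ × ℝ => MvPolynomial.eval ![p.1, p.2] Φ) ∘ fun b : ℝ => ((u.1, b) : ℝ × ℝ)) =
      fun s => MvPolynomial.eval ![u.1, s] Φ := by
    funext s; rfl
  rw [hfun] at h1
  have := h1.unique h2
  simp only [mul_zero, zero_add, mul_one] at this
  rw [ContinuousLinearMap.comp_apply, ContinuousLinearMap.inr_apply]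
  exact this

/-- … hence invertible when `∂_bΦ(u) ≠ 0`. [folklore] -/
theorem isInvertible_fderiv_eval₂_inr (Φ : MvPolynomial (Fin 2) ℝ) (u : ℝ × ℝ)
    (h : MvPolynomial.eval ![u.1, u.2] (pderiv 1 Φ) ≠ 0) :
    (fderiv ℝ (fun p : ℝ × ℝ => MvPolynomial.eval ![p.1, p.2] Φ) u ∘L ContinuousLinearMap.inr ℝ ℝ ℝ).IsInvertible := by
  refine ⟨ContinuousLinearEquiv.unitsEquivAut ℝ (Units.mk0 _ h), ?_⟩
  refine ContinuousLinearMap.ext_ring ?_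
  rw [fderiv_eval₂_inr, ContinuousLinearEquiv.coe_coe, ContinuousLinearEquiv.unitsEquivAut_apply, Units.val_mk0,
    one_mul]

/-- **The local implicit branch.**  At a point of the curve `Φ = 0` with `∂_bΦ ≠ 0` there is a function `β`, smooth at
`t₀`, with `β t₀ = b₀`, `Φ(t, β t) = 0` for `t` near `t₀`, and — local uniqueness — near `(t₀, b₀)` the curve IS the
graph of `β`. [folklore] -/
theorem exists_local_branch (Φ : MvPolynomial (Fin 2) ℝ) {t₀ b₀ : ℝ}
    (hΦ : MvPolynomial.eval ![t₀, b₀] Φ = 0) (hΦ1 : MvPolynomial.eval ![t₀, b₀] (pderiv 1 Φ) ≠ 0) :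
    ∃ β : ℝ → ℝ, β t₀ = b₀ ∧ ContDiffAt ℝ ⊤ β t₀ ∧ (∀ᶠ t in 𝓝 t₀, MvPolynomial.eval ![t, β t] Φ = 0) ∧
      ∀ᶠ v in 𝓝 ((t₀, b₀) : ℝ × ℝ), MvPolynomial.eval ![v.1, v.2] Φ = 0 ↔ β v.1 = v.2 := by
  have hcd : ContDiffAt ℝ ⊤ (fun p : ℝ × ℝ => MvPolynomial.eval ![p.1, p.2] Φ) (t₀, b₀) :=
    (contDiff_eval₂ Φ).contDiffAt
  have hinv := isInvertible_fderiv_eval₂_inr Φ (t₀, b₀) hΦ1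
  have htop : (⊤ : WithTop ℕ∞) ≠ 0 := by simp
  refine ⟨hcd.implicitFunction htop hinv, hcd.implicitFunction_apply_self htop hinv,
    hcd.contDiffAt_implicitFunction htop hinv, ?_, ?_⟩
  · have h := hcd.eventually_apply_implicitFunction htop hinv
    exact h.mono fun t ht => by rw [ht]; exact hΦ
  · have h := hcd.eventually_apply_eq_iff_implicitFunction htop hinv
    exact h.mono fun v hv => by rw [← hv, hΦ]

/-- **Local branches everywhere, for hyperbolic families in general position.**  If the vertical family
`P t = Φ(t, ·)` splits over `ℝ` for `t > 0`, the osculation set is finite and `∂_bΦ ≠ 0` on it, then through EVERY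
point `(t₀, b₀)` of the curve in the open quadrant passes a unique local smooth branch `b = β(t)`. [folklore] -/
theorem exists_local_branch_of_hyperbolic (Φ : MvPolynomial (Fin 2) ℝ) (P : ℝ → ℝ[X])
    (hP : ∀ t b, (P t).eval b = MvPolynomial.eval ![t, b] Φ) (hsplit : ∀ t, 0 < t → (P t).Splits)
    (hfin : {p : Fin 2 → ℝ | 0 < p 0 ∧ 0 < p 1 ∧ MvPolynomial.eval p Φ = 0 ∧
      MvPolynomial.eval p
        (MvPolynomial.X 0 * MvPolynomial.pderiv 0 (MvPolynomial.X 0 * MvPolynomial.pderiv 0 Φ)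
            * (MvPolynomial.X 1 * MvPolynomial.pderiv 1 Φ) ^ 2
          - 2 * (MvPolynomial.X 0 * MvPolynomial.pderiv 0 (MvPolynomial.X 1 * MvPolynomial.pderiv 1 Φ))
            * (MvPolynomial.X 0 * MvPolynomial.pderiv 0 Φ) * (MvPolynomial.X 1 * MvPolynomial.pderiv 1 Φ)
          + MvPolynomial.X 1 * MvPolynomial.pderiv 1 (MvPolynomial.X 1 * MvPolynomial.pderiv 1 Φ)
            * (MvPolynomial.X 0 * MvPolynomial.pderiv 0 Φ) ^ 2) = 0}.Finite)
    (hgp : ∀ p ∈ {p : Fin 2 → ℝ | 0 < p 0 ∧ 0 < p 1 ∧ MvPolynomial.eval p Φ = 0 ∧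
      MvPolynomial.eval p
        (MvPolynomial.X 0 * MvPolynomial.pderiv 0 (MvPolynomial.X 0 * MvPolynomial.pderiv 0 Φ)
            * (MvPolynomial.X 1 * MvPolynomial.pderiv 1 Φ) ^ 2
          - 2 * (MvPolynomial.X 0 * MvPolynomial.pderiv 0 (MvPolynomial.X 1 * MvPolynomial.pderiv 1 Φ))
            * (MvPolynomial.X 0 * MvPolynomial.pderiv 0 Φ) * (MvPolynomial.X 1 * MvPolynomial.pderiv 1 Φ)
          + MvPolynomial.X 1 * MvPolynomial.pderiv 1 (MvPolynomial.X 1 * MvPolynomial.pderiv 1 Φ)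
            * (MvPolynomial.X 0 * MvPolynomial.pderiv 0 Φ) ^ 2) = 0},
        MvPolynomial.eval p (MvPolynomial.pderiv 1 Φ) ≠ 0)
    {t₀ b₀ : ℝ} (ht₀ : 0 < t₀) (hb₀ : 0 < b₀) (hΦ : MvPolynomial.eval ![t₀, b₀] Φ = 0) :
    ∃ β : ℝ → ℝ, β t₀ = b₀ ∧ ContDiffAt ℝ ⊤ β t₀ ∧ (∀ᶠ t in 𝓝 t₀, MvPolynomial.eval ![t, β t] Φ = 0) ∧
      ∀ᶠ v in 𝓝 ((t₀, b₀) : ℝ × ℝ), MvPolynomial.eval ![v.1, v.2] Φ = 0 ↔ β v.1 = v.2 := by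
  refine exists_local_branch Φ hΦ fun hΦ1 => ?_
  have hP0 : P t₀ ≠ 0 := fun h0 => not_finite_of_vanishing_fibre Φ P hP ht₀ h0 hfin
  have hle := rootMultiplicity_le_one_of_finite Φ P hP hsplit hfin hgp ht₀ hb₀
  have hroot : (P t₀).IsRoot b₀ := by rw [IsRoot, hP]; exact hΦ
  have hder : (derivative (P t₀)).IsRoot b₀ := by
    rw [IsRoot, ← eval_pderiv_one_eq_derivative Φ P hP]; exact hΦ1
  have hlt : 1 < (P t₀).rootMultiplicity b₀ := by
    rw [one_lt_rootMultiplicity_iff_isRoot_iterate_derivative hP0]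
    intro m hm
    interval_cases m
    · exact hroot
    · exact hder
  omega

end OsculationPeel

end Summit.ValiantsHypothesis.ValiantsHypothesis.Theorems.LacunarySymmetroidMatrixDescartes

end
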